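import Summits.ABC.IUTFork.LDHGenuineHullRegimeSzpiroSlack
import Summits.ABC.ABC.Theorems.IUTThetaPilotThetaPartIIULineCapstone
import HarnessLib

/-!
# Branch C, CONE binder `hvol` / `hreg` of `abc_of_S_v3` / `abc_of_S_v4`: the binder FOLLOWS from a DATUM-FREE Szpiro-type
# inequality on the admissible Legendre points — the prove-direction half of the Szpiro-type certificate, composed to the binder
# and to the route's (U)-line capstone (abc-iut cell, R2 S-chain team seat abc-iut-s2-p1; crux ThetaPartII = stmt-ABC-19678)

PROOF-ONLY file (D-0012) of the abc-iut cell; TAKES NO SIDE on [IUTchIII] Cor. 3.12 or on the (U)/(P) readings of "−|log(Θ)|".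
Mochizuki, *Inter-universal Teichmüller theory IV* (RIMS manuscript Apr. 2020 = PRIMS **57** (2021)), Thm. 1.10 proof Steps (ii)–(viii)
pp. 24–30, Cor. 2.2 (ii) proof pp. 43–48 ((P2), (P5), (P6) p. 45–46); Dupuy–Hilado [DupuyHilado2025] §4.7, §4.11–4.12.

WHAT IS PROVED (compositions BY NAME; no definition, no new `Prop`). Write `B_III(P,l)` for the registered constant of the CONE binder
`hvol` of `Conditional/AbcOfSGenuine.lean` (`abc_of_S_v3`, p430884) / `hreg` of `Conditional/AbcOfSGenuineRegime.lean` (`abc_of_S_v4`,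
p431657), and `SzpiroSuff(P,l)` for the DATUM-FREE, IUT-free inequality
`log(q^{∤{2,l}}(λ)) ≤ (24(d_mod−1)/l)·(log-diff + log-cond) + 40·log(d*·l)·max(0, π(d*·l) − (2·d_mod·(log-diff + log-cond) + log(30·l))/log 2)`
(`d* = 2^12·3^3·5·d_mod`; an abc/Szpiro-type inequality for `λ` with conductor coefficient `24(d_mod−1)/l` and an explicit nonnegative
additive term):
* `PointDict.hullVolumeAtDatum_BIII_of_logQAvoid_le_szpiroMax` — `SzpiroSuff(P,l) → Cor22.HullVolumeAtDatum P l (B_III P l)` for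
  `λ ∈ U_P` minimal, `l ≥ 7` (the `max(0,·)` form of abc-iut-s2-p1's `hullVolumeAtDatum_BIII_of_logQAvoid_le_szpiro(')`: the slot residue
  is absorbed by the FULL slack of `B_III` — Step (viii) prime-count slack AND the Step (iii) conductor share `4(d_mod−1)/l`);
* `Conditional.hvol_of_szpiroSuff` — the CONE binder `hvol` of `abc_of_S_v3` VERBATIM follows from `SzpiroSuff` demanded ONLY at
  admissible `(P, l)` with `d_mod ≥ 2` (at `d_mod = 1` the binder is abc-iut-S3's THEOREM `hullVolumeAtDatum_BIII_pinned_of_dmod_eq_one`;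
  `7 ≤ l` from (P6) by abc-iut-c312-8's `ThetaPartII.seven_le_of_condP6`);
* `Conditional.hreg_of_szpiroSuff` — the same for v4's `hreg` (the regime hypothesis is simply not used);
* `Conditional.ABC_of_cor312_of_szpiroSuff` — ON THE (U) LINE, `ABC` from [IUTchIII] Cor. 3.12 at the genuine Θ-volume data of the
  admissible Legendre points (`stub_cor312` signature — DISPUTED, claim form) AND `SzpiroSuff` at `d_mod ≥ 2` ALONE (abc-iut-c312-8's
  capstone `ThetaPartII.ABC_of_cor312_of_hullRegime`, with [GenEll] Thm 2.1 at `Σ = {2}` and every other step PROVED inside).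
So `abc_of_S_v3 H (hvol_of_szpiroSuff hSz) : ABC` and `abc_of_S_v4 H (hreg_of_szpiroSuff hSz) : ABC` are one-liners for the C lead.

READING (for the planners; nothing asserted about print). Together with the NECESSITY half (abc-iut-S8 `PointDict.slotResidue_le_of_hullVolumeAtDatum`,
abc-iut-S7 `PointDict.ordPair_le_of_hullVolumeAtDatum`, abc-iut-s2-p5's datum-free form): at `d_mod ≥ 2` the CONE binder of the branch-C
certificate is SANDWICHED between two explicit, Θ-free, IUT-free abc/Szpiro-type inequalities for the admissible `λ` (sufficient: conductor
coefficient `24(d_mod−1)/l`; necessary: `6(1+12d_mod/l)/(Pr(v)Pr(w))` on the split local height) — i.e. the (U)-reading residual of the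
route `IUTThetaPilot` is a Diophantine statement OF THE SAME TYPE AS THE ROUTE'S CONCLUSION: closing it by a volume computation would prove an
effective Szpiro-type bound, refuting it in-cell would exhibit a Szpiro-violating admissible `λ`. The antecedent `SzpiroSuff` is NOT claimed to
hold (as a `∀`-statement over all admissible `(P,l)` it is at least as strong as a uniform effective abc inequality with constant `24(d_mod−1)/l`
at small `l`); it is displayed to make the type of the residual kernel-visible. HONEST SCOPE: conditional theorems; no datum constructed; no
side taken on Cor. 3.12 / Thm. 1.10 or on any author; typed ≠ proved. [cite: Mochizuki2012, IUTchIV Thm. 1.10 proof Steps (ii)–(viii) p. 24–30]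
[cite: Mochizuki2012, IUTchIV Cor. 2.2 (ii) proof p. 45–46] [claim: Mochizuki2012, status: disputed] for every IUT quotation.
-/

noncomputable section

open Literature.IUT.HodgeTheaters Literature.IUT.LogVolume NumberField IsDedekindDomain
open Literature.NumberTheory.DiophantineGeometry.GenEll

namespace Summit.ABC.IUTFork

namespace PointDict

variable {P : NFPoint} {l : ℕ}

/-- `log((2^12·3^3·5·d)·l) ≥ 0` for `d, l ≥ 1`. [cite: Mochizuki2012, IUTchIV Thm. 1.10 p. 22] -/
private theorem log_dstar_mul_nonneg₅ {d l : ℕ} (hd : 1 ≤ d) (hl : 1 ≤ l) :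
    0 ≤ Real.log (((2 ^ 12 * 3 ^ 3 * 5 * d : ℕ) : ℝ) * l) := by
  apply Real.log_nonneg
  have h1 : (1 : ℝ) ≤ ((2 ^ 12 * 3 ^ 3 * 5 * d : ℕ) : ℝ) := by exact_mod_cast (by nlinarith : 1 ≤ 2 ^ 12 * 3 ^ 3 * 5 * d)
  have h2 : (1 : ℝ) ≤ (l : ℝ) := by exact_mod_cast hl
  nlinarith

/-- **`T.HullEstimateOf (B_III P l)` under the `max(0,·)` Szpiro-type inequality**: for `λ ∈ U_P` (minimally presented), `l ≥ 7` and every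
genuine Θ-volume datum `T` at `(P, l)`,
`log(q^{∤{2,l}}(λ)) ≤ (24(d_mod−1)/l)·(log-diff + log-cond) + 40·log(d*·l)·max(0, π(d*·l) − (2·d_mod·(log-diff + log-cond) + log(30·l))/log 2)`
implies the (U)-hull estimate with print's `B_III` — both count bounds at once (`#{p ∈ T(I) : p ≤ d*l} ≤ π(d*l)` and abc-iut-S3's
`#T(I)·log 2 ≤ 2·d_mod·(log-diff + log-cond) + log(30·l)`), over abc-iut-s2-p1's `hullEstimateOf_BIII_of_slotResidue_le_szpiroSlack`.
[cite: Mochizuki2012, IUTchIV Thm. 1.10 proof Steps (ii)–(viii) p. 24–30] [claim: Mochizuki2012, status: disputed] -/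
theorem hullEstimateOf_BIII_of_logQAvoid_le_szpiroMax (T : Cor22.ThetaVolumeDatumAt P l) (hP : P ∈ UP) (h7 : 7 ≤ l)
    (h : Cor22.logQAvoid P {2, l} ≤
      24 * ((Cor22.dmod P : ℝ) - 1) / l * (P.logDiff + Cor22.logCondAvoid P {2, l})
      + 40 * Real.log (((2 ^ 12 * 3 ^ 3 * 5 * Cor22.dmod P : ℕ) : ℝ) * l)
        * max 0 (((Nat.primeCounting (2 ^ 12 * 3 ^ 3 * 5 * Cor22.dmod P * l) : ℝ)
          - (2 * (Cor22.dmod P : ℝ) * (P.logDiff + Cor22.logCondAvoid P {2, l}) + Real.log (2 * 3 * 5 * (l : ℝ)))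
            / Real.log 2))) :
    T.HullEstimateOf (((l : ℝ) + 1) / 4 * ((1 + 12 * (Cor22.dmod P : ℝ) / l) * (P.logDiff + Cor22.logCondAvoid P {2, l})
      + 2 * Real.log l + 52 + 20 / 3 * Real.log (((2 ^ 12 * 3 ^ 3 * 5 * Cor22.dmod P : ℕ) : ℝ) * (l : ℝ))
        * (Nat.primeCounting (2 ^ 12 * 3 ^ 3 * 5 * Cor22.dmod P * l) : ℝ))) := by
  classical
  letI := T.instFieldF; letI := T.instNumberFieldF; letI := T.instAlgebraF; letI := T.instFieldK
  letI := T.instNumberFieldK; letI := T.instAlgebraK; letI := T.instIsElliptic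
  have hl1 : 1 ≤ l := by omega
  have hd : 1 ≤ Cor22.dmod P := Cor22.dmod_pos P
  have hlmod := log_dstar_mul_nonneg₅ hd hl1
  refine hullEstimateOf_BIII_of_slotResidue_le_szpiroSlack T hP h7 ?_
  have hres := slotResidue_le_logQAvoid T
  have hcntB := card_supportPrimes_filter_le T hP (2 ^ 12 * 3 ^ 3 * 5 * Cor22.dmod P * l)
  -- `#{p ∈ T(I) : p ≤ N} ≤ π(N)` (every support prime is prime)
  have hcntπ : (((T.I.supportPrimes.filter (· ≤ 2 ^ 12 * 3 ^ 3 * 5 * Cor22.dmod P * l)).card : ℝ)) ≤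
      (Nat.primeCounting (2 ^ 12 * 3 ^ 3 * 5 * Cor22.dmod P * l) : ℝ) := by
    have hsub : T.I.supportPrimes.filter (· ≤ 2 ^ 12 * 3 ^ 3 * 5 * Cor22.dmod P * l) ⊆
        Nat.primesLE (2 ^ 12 * 3 ^ 3 * 5 * Cor22.dmod P * l) := by
      intro p hp
      rw [Finset.mem_filter] at hp
      rw [Nat.mem_primesLE]
      exact ⟨hp.2, T.I.prime_of_mem_supportPrimes hp.1⟩
    have hc : (T.I.supportPrimes.filter (· ≤ 2 ^ 12 * 3 ^ 3 * 5 * Cor22.dmod P * l)).card ≤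
        Nat.primeCounting (2 ^ 12 * 3 ^ 3 * 5 * Cor22.dmod P * l) := by
      rw [← Nat.primesLE_card_eq_primeCounting]; exact Finset.card_le_card hsub
    exact_mod_cast hc
  -- `max(0, π − B) ≤ π − count`
  have hmax : max 0 (((Nat.primeCounting (2 ^ 12 * 3 ^ 3 * 5 * Cor22.dmod P * l) : ℝ)
          - (2 * (Cor22.dmod P : ℝ) * (P.logDiff + Cor22.logCondAvoid P {2, l}) + Real.log (2 * 3 * 5 * (l : ℝ)))
            / Real.log 2)) ≤
      ((Nat.primeCounting (2 ^ 12 * 3 ^ 3 * 5 * Cor22.dmod P * l) : ℝ)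
        - ((T.I.supportPrimes.filter (· ≤ 2 ^ 12 * 3 ^ 3 * 5 * Cor22.dmod P * l)).card : ℝ)) :=
    max_le (by linarith) (by linarith)
  have hl0 : (0 : ℝ) ≤ ((l : ℝ) + 1) / 24 := by positivity
  have hc0 : (0 : ℝ) ≤ ((l : ℝ) + 1) / 4 := by positivity
  have h1 := mul_le_mul_of_nonneg_left h hl0
  have h2 := mul_le_mul_of_nonneg_left hmax hlmod
  have h3 : ((l : ℝ) + 1) / 24 * (24 * ((Cor22.dmod P : ℝ) - 1) / l * (P.logDiff + Cor22.logCondAvoid P {2, l})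
      + 40 * Real.log (((2 ^ 12 * 3 ^ 3 * 5 * Cor22.dmod P : ℕ) : ℝ) * l)
        * max 0 (((Nat.primeCounting (2 ^ 12 * 3 ^ 3 * 5 * Cor22.dmod P * l) : ℝ)
          - (2 * (Cor22.dmod P : ℝ) * (P.logDiff + Cor22.logCondAvoid P {2, l}) + Real.log (2 * 3 * 5 * (l : ℝ)))
            / Real.log 2))) ≤
      ((l : ℝ) + 1) / 4 * (4 * ((Cor22.dmod P : ℝ) - 1) / l * (P.logDiff + Cor22.logCondAvoid P {2, l})
        + 20 / 3 * Real.log (((2 ^ 12 * 3 ^ 3 * 5 * Cor22.dmod P : ℕ) : ℝ) * l)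
          * ((Nat.primeCounting (2 ^ 12 * 3 ^ 3 * 5 * Cor22.dmod P * l) : ℝ)
            - ((T.I.supportPrimes.filter (· ≤ 2 ^ 12 * 3 ^ 3 * 5 * Cor22.dmod P * l)).card : ℝ))) := by
    have e : ((l : ℝ) + 1) / 24 * (24 * ((Cor22.dmod P : ℝ) - 1) / l * (P.logDiff + Cor22.logCondAvoid P {2, l})
        + 40 * Real.log (((2 ^ 12 * 3 ^ 3 * 5 * Cor22.dmod P : ℕ) : ℝ) * l)
          * max 0 (((Nat.primeCounting (2 ^ 12 * 3 ^ 3 * 5 * Cor22.dmod P * l) : ℝ)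
            - (2 * (Cor22.dmod P : ℝ) * (P.logDiff + Cor22.logCondAvoid P {2, l}) + Real.log (2 * 3 * 5 * (l : ℝ)))
              / Real.log 2))) =
        ((l : ℝ) + 1) / 4 * (4 * ((Cor22.dmod P : ℝ) - 1) / l * (P.logDiff + Cor22.logCondAvoid P {2, l})
          + 20 / 3 * (Real.log (((2 ^ 12 * 3 ^ 3 * 5 * Cor22.dmod P : ℕ) : ℝ) * l)
            * max 0 (((Nat.primeCounting (2 ^ 12 * 3 ^ 3 * 5 * Cor22.dmod P * l) : ℝ)
              - (2 * (Cor22.dmod P : ℝ) * (P.logDiff + Cor22.logCondAvoid P {2, l}) + Real.log (2 * 3 * 5 * (l : ℝ)))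
                / Real.log 2)))) := by ring
    rw [e]
    apply mul_le_mul_of_nonneg_left _ hc0
    have h20 := mul_le_mul_of_nonneg_left h2 (show (0 : ℝ) ≤ 20 / 3 by norm_num)
    have e2 : 20 / 3 * (Real.log (((2 ^ 12 * 3 ^ 3 * 5 * Cor22.dmod P : ℕ) : ℝ) * l)
        * ((Nat.primeCounting (2 ^ 12 * 3 ^ 3 * 5 * Cor22.dmod P * l) : ℝ)
          - ((T.I.supportPrimes.filter (· ≤ 2 ^ 12 * 3 ^ 3 * 5 * Cor22.dmod P * l)).card : ℝ))) =
        20 / 3 * Real.log (((2 ^ 12 * 3 ^ 3 * 5 * Cor22.dmod P : ℕ) : ℝ) * l)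
          * ((Nat.primeCounting (2 ^ 12 * 3 ^ 3 * 5 * Cor22.dmod P * l) : ℝ)
            - ((T.I.supportPrimes.filter (· ≤ 2 ^ 12 * 3 ^ 3 * 5 * Cor22.dmod P * l)).card : ℝ)) := by ring
    linarith
  exact hres.trans (h1.trans h3)

/-- **The `∀ T` form: `Cor22.HullVolumeAtDatum P l (B_III P l)` at every `(P, l)` with `λ ∈ U_P` (minimally presented), `l ≥ 7`,
satisfying the `max(0,·)` Szpiro-type inequality.** DATUM-FREE, IUT-free antecedent.
[cite: Mochizuki2012, IUTchIV Thm. 1.10 proof Steps (ii)–(viii) p. 24–30] [claim: Mochizuki2012, status: disputed] -/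
theorem hullVolumeAtDatum_BIII_of_logQAvoid_le_szpiroMax (hP : P ∈ UP) (h7 : 7 ≤ l)
    (h : Cor22.logQAvoid P {2, l} ≤
      24 * ((Cor22.dmod P : ℝ) - 1) / l * (P.logDiff + Cor22.logCondAvoid P {2, l})
      + 40 * Real.log (((2 ^ 12 * 3 ^ 3 * 5 * Cor22.dmod P : ℕ) : ℝ) * l)
        * max 0 (((Nat.primeCounting (2 ^ 12 * 3 ^ 3 * 5 * Cor22.dmod P * l) : ℝ)
          - (2 * (Cor22.dmod P : ℝ) * (P.logDiff + Cor22.logCondAvoid P {2, l}) + Real.log (2 * 3 * 5 * (l : ℝ)))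
            / Real.log 2))) :
    Cor22.HullVolumeAtDatum P l (((l : ℝ) + 1) / 4 * ((1 + 12 * (Cor22.dmod P : ℝ) / l)
      * (P.logDiff + Cor22.logCondAvoid P {2, l}) + 2 * Real.log l + 52
        + 20 / 3 * Real.log (((2 ^ 12 * 3 ^ 3 * 5 * Cor22.dmod P : ℕ) : ℝ) * (l : ℝ))
          * (Nat.primeCounting (2 ^ 12 * 3 ^ 3 * 5 * Cor22.dmod P * l) : ℝ))) :=
  fun T => hullEstimateOf_BIII_of_logQAvoid_le_szpiroMax T hP h7 h

end PointDict

namespace Conditional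

/-- **The CONE binder `hvol` of `abc_of_S_v3` FOLLOWS from the datum-free Szpiro-type inequality at `d_mod ≥ 2`.** For every admissible
`(λ, l)` (`λ ∈ U_X` minimal, `l` prime `≥ 5`, «admits an `F`-core», (P2), (P5), (P6)): if
`log(q^{∤{2,l}}(λ)) ≤ (24(d_mod−1)/l)·(log-diff + log-cond) + 40·log(d*·l)·max(0, π(d*·l) − (2·d_mod·(log-diff + log-cond) + log(30·l))/log 2)`
whenever `d_mod ≥ 2`, then `Cor22.HullVolumeAtDatum λ l (B_III λ l)` at every admissible `(λ, l)` — the `hvol` binder VERBATIM. At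
`d_mod = 1`: abc-iut-S3's theorem `PointDict.hullVolumeAtDatum_BIII_pinned_of_dmod_eq_one` with abc-iut-S1's (R4)
`Cor22.ThetaVolumeDatumAt.R4_towerFact`; `7 ≤ l` from (P6) (abc-iut-c312-8
`ThetaPartII.seven_le_of_condP6`). Usage: `abc_of_S_v3 H (hvol_of_szpiroSuff hSz)`. Nothing asserted about the antecedent.
[cite: Mochizuki2012, IUTchIV Thm. 1.10 proof Steps (ii)–(viii) p. 24–30] [claim: Mochizuki2012, status: disputed] -/
theorem hvol_of_szpiroSuff
    (hSz : ∀ P : NFPoint, P ∈ UP → ∀ l : ℕ, l.Prime → 5 ≤ l →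
      Cor22.AdmitsCore P → Cor22.CondP2 P l → Cor22.CondP5 P l → Cor22.CondP6 P l → 2 ≤ Cor22.dmod P →
      Cor22.logQAvoid P {2, l} ≤
        24 * ((Cor22.dmod P : ℝ) - 1) / l * (P.logDiff + Cor22.logCondAvoid P {2, l})
        + 40 * Real.log (((2 ^ 12 * 3 ^ 3 * 5 * Cor22.dmod P : ℕ) : ℝ) * l)
          * max 0 (((Nat.primeCounting (2 ^ 12 * 3 ^ 3 * 5 * Cor22.dmod P * l) : ℝ)
            - (2 * (Cor22.dmod P : ℝ) * (P.logDiff + Cor22.logCondAvoid P {2, l}) + Real.log (2 * 3 * 5 * (l : ℝ)))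
              / Real.log 2))) :
    ∀ P₀ : NFPoint, P₀ ∈ UP → ∀ l : ℕ, l.Prime → 5 ≤ l →
      Cor22.AdmitsCore P₀ → Cor22.CondP2 P₀ l → Cor22.CondP5 P₀ l → Cor22.CondP6 P₀ l →
        Cor22.HullVolumeAtDatum P₀ l (((l : ℝ) + 1) / 4 *
          ((1 + 12 * (Cor22.dmod P₀ : ℝ) / l) * (P₀.logDiff + Cor22.logCondAvoid P₀ {2, l})
            + 2 * Real.log l + 52
            + 20 / 3 * Real.log (((2 ^ 12 * 3 ^ 3 * 5 * Cor22.dmod P₀ : ℕ) : ℝ) * (l : ℝ))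
              * (Nat.primeCounting (2 ^ 12 * 3 ^ 3 * 5 * Cor22.dmod P₀ * l) : ℝ))) := by
  intro P hP l hl h5 hc h2 h5' h6
  have h7 : 7 ≤ l := Summit.ABC.ABC.Theorems.ThetaPartII.seven_le_of_condP6 hP hl h5 h6
  by_cases hd : Cor22.dmod P = 1
  · exact PointDict.hullVolumeAtDatum_BIII_pinned_of_dmod_eq_one hP h7 hd (fun T => T.R4_towerFact hP)
  · have hd2 : 2 ≤ Cor22.dmod P := by have := Cor22.dmod_pos P; omega
    exact PointDict.hullVolumeAtDatum_BIII_of_logQAvoid_le_szpiroMax hP h7 (hSz P hP l hl h5 hc h2 h5' h6 hd2)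

/-- **The CONE binder `hreg` of `abc_of_S_v4` FOLLOWS from the same datum-free Szpiro-type inequality at `d_mod ≥ 2`** (the regime
hypothesis «not slot-constant» is not used: the sufficient condition covers every datum). Usage: `abc_of_S_v4 H (hreg_of_szpiroSuff hSz)`.
Nothing asserted about the antecedent. [cite: Mochizuki2012, IUTchIV Thm. 1.10 proof Steps (ii)–(viii) p. 24–30]
[claim: Mochizuki2012, status: disputed] -/
theorem hreg_of_szpiroSuff
    (hSz : ∀ P : NFPoint, P ∈ UP → ∀ l : ℕ, l.Prime → 5 ≤ l →
      Cor22.AdmitsCore P → Cor22.CondP2 P l → Cor22.CondP5 P l → Cor22.CondP6 P l → 2 ≤ Cor22.dmod P →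
      Cor22.logQAvoid P {2, l} ≤
        24 * ((Cor22.dmod P : ℝ) - 1) / l * (P.logDiff + Cor22.logCondAvoid P {2, l})
        + 40 * Real.log (((2 ^ 12 * 3 ^ 3 * 5 * Cor22.dmod P : ℕ) : ℝ) * l)
          * max 0 (((Nat.primeCounting (2 ^ 12 * 3 ^ 3 * 5 * Cor22.dmod P * l) : ℝ)
            - (2 * (Cor22.dmod P : ℝ) * (P.logDiff + Cor22.logCondAvoid P {2, l}) + Real.log (2 * 3 * 5 * (l : ℝ)))
              / Real.log 2))) :
    ∀ P : NFPoint, P ∈ UP → ∀ l : ℕ, l.Prime → 5 ≤ l →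
      Cor22.AdmitsCore P → Cor22.CondP2 P l → Cor22.CondP5 P l → Cor22.CondP6 P l →
      ∀ T : Cor22.ThetaVolumeDatumAt P l,
        (letI := T.instFieldF; letI := T.instNumberFieldF; letI := T.instAlgebraF; letI := T.instFieldK
         letI := T.instNumberFieldK; letI := T.instAlgebraK; letI := T.instFieldFbar; letI := T.instAlgebraFbar
         letI := T.instAlgebraKFbar; letI := T.instIsElliptic
         ¬ (∀ p ∈ T.I.supportPrimes, ∀ v w : placesOver (fieldOfModuli T.E) p,
            (Summit.ABC.IUTFork.DHData.ofInput T.I).logQloc p v = (Summit.ABC.IUTFork.DHData.ofInput T.I).logQloc p w)) →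
        T.HullEstimateOf
          (((l : ℝ) + 1) / 4 *
            ((1 + 12 * (Cor22.dmod P : ℝ) / l) * (P.logDiff + Cor22.logCondAvoid P {2, l})
              + 2 * Real.log l + 52
              + 20 / 3 * Real.log (((2 ^ 12 * 3 ^ 3 * 5 * Cor22.dmod P : ℕ) : ℝ) * (l : ℝ))
                * (Nat.primeCounting (2 ^ 12 * 3 ^ 3 * 5 * Cor22.dmod P * l) : ℝ))) :=
  fun P hP l hl h5 hc h2 h5' h6 T _ => hvol_of_szpiroSuff hSz P hP l hl h5 hc h2 h5' h6 T

/-- **ON THE (U) LINE: `ABC` from [IUTchIII] Cor. 3.12 at the genuine Θ-volume data of the admissible Legendre points AND the datum-free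
Szpiro-type inequality at `d_mod ≥ 2` ALONE** — abc-iut-c312-8's capstone `ThetaPartII.ABC_of_cor312_of_hullRegime` (route `IUTThetaPilot`,
crux stmt-ABC-19678; [GenEll] Thm 2.1 at `Σ = {2}`, the Θ-data (P7), the tower arithmetic, Thm. 1.10's numerics and Cor. 2.2's reduction
PROVED inside) with its second OPEN stub fed by `hreg_of_szpiroSuff`. The kernel thus says: on the (U) reading the route needs, besides
the disputed Corollary, an abc/Szpiro-type input for the points of `d_mod ≥ 2` — a statement of the same type as its conclusion. CONDITIONAL;
nothing asserted about either hypothesis; no side taken. [cite: Mochizuki2012, IUTchIV Cor. 2.2 (ii) proof p. 45–46]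
[claim: Mochizuki2012, status: disputed] -/
theorem ABC_of_cor312_of_szpiroSuff
    (h312 : ∀ P : NFPoint, P ∈ UP → ∀ l : ℕ, l.Prime → 5 ≤ l →
      Cor22.AdmitsCore P → Cor22.CondP2 P l → Cor22.CondP5 P l → Cor22.CondP6 P l →
        Cor22.Cor312AtDatum P l)
    (hSz : ∀ P : NFPoint, P ∈ UP → ∀ l : ℕ, l.Prime → 5 ≤ l →
      Cor22.AdmitsCore P → Cor22.CondP2 P l → Cor22.CondP5 P l → Cor22.CondP6 P l → 2 ≤ Cor22.dmod P →
      Cor22.logQAvoid P {2, l} ≤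
        24 * ((Cor22.dmod P : ℝ) - 1) / l * (P.logDiff + Cor22.logCondAvoid P {2, l})
        + 40 * Real.log (((2 ^ 12 * 3 ^ 3 * 5 * Cor22.dmod P : ℕ) : ℝ) * l)
          * max 0 (((Nat.primeCounting (2 ^ 12 * 3 ^ 3 * 5 * Cor22.dmod P * l) : ℝ)
            - (2 * (Cor22.dmod P : ℝ) * (P.logDiff + Cor22.logCondAvoid P {2, l}) + Real.log (2 * 3 * 5 * (l : ℝ)))
              / Real.log 2))) :
    _root_.ABC :=
  Summit.ABC.ABC.Theorems.ThetaPartII.ABC_of_cor312_of_hullRegime h312 (hreg_of_szpiroSuff hSz)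

end Conditional

end Summit.ABC.IUTFork

end
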